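import Mathlib
import HarnessLib
import Summits.HubbardSuperconductivity.HubbardSuperconductivity.Theorems.KLProgrammeKLRegimeVolumeLimitEngineRatesDoor

/-!
# Child `KLRegimeVolumeLimitV14` (stmt-HubbardSuperconductivity-19921, skeleton «cauchy» v2 6f46346070479240), stub `stub_vl_rates`:
# THE DENSITY RATE (b1) IS IMPLIED BY THE BARE-CARRIER RATE — `stub_vl_rates` from ONE same-cutoff engine statement
# (seat hubbard-kl-k3c5-p2, g4; technique «analytic-continuation-free assembly via FinalTwoLegVolLimit»)

k3c4-p1's door `stub_vl_rates_of_engineRates` (p497102) asks the engine lineage for TWO same-cutoff two-volume rates: (i) of the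
occupation ratio (⇒ (b1), the density `occ∞`) and (ii) of the bare last-scale self-energy, label-uniform with a torus modulus (⇒ with (i),
(b2)).  This file removes (i): **(ii) alone implies (b1)**.  At the zone centre `k = k′ = 0` the modulus term vanishes, so (ii) and
`kler_carrierRate_of_sameCutoff` give `‖Σ∞⁰_L(n,0) − Σ∞⁰_{L′}(n,0)‖ ≤ ρ L` for EVERY Matsubara integer `n`; by k3c5-p3's bare-frame form
`Σ∞⁰ = U·occ∞ + U²·Six∞` (`klSelfEnergyInf_zero_frame`) and the RIEMANN–LEBESGUE LEMMA in the Matsubara label at fixed volume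
(`tendsto_klSixInf_natCast_atTop`: `Six∞_L(n,p) → 0` as `n → ∞`, every `U`, `μ`, `L`, `β > 0` — `Six∞_L(n,p)` is `D∞⁻¹` times the
`ω_n`-Fourier coefficient of an `[0,β]`-supported function), letting `n → ∞` leaves `‖U·(occ∞(L) − occ∞(L′))‖ ≤ ρ L`
(`kler_occRate_of_carrierRate`).  Hence **`stub_vl_rates_of_carrierRate`**: the REGISTERED text of `stub_vl_rates` VERBATIM from, under
its own binder prefix, `∃ L₀ D ρ → 0` with the same-cutoff two-volume rate `ρ L + D·Σ_i |p_k i − p′_{k′} i|_𝕋` of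
`klSelfEnergy L M β U μ 0 klE0 (nScales β + 1) (ω, ·) 0` for all `M` beyond a threshold `M₀(L, L′)` — ONE export for the engine
(`ρ₁ = ρ/U`, `ρ₂′ = 2ρ/U²`, `D₂ = D/U²`, threshold `max L₀ 3`).  Everything is proved; no definition.
-/

noncomputable section

namespace Summit.HubbardSuperconductivity.HubbardSuperconductivity.Theorems.KLRegimeVolumeLimit

set_option linter.dupNamespace false -- summit = problem name (single-conjunct summit), D-0017

open Filter Topology Finset MeasureTheory FourierTransform Literature.MathematicalPhysics.QuantumLattice Literature.Probability.LatticeModels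
  GrassmannAlgebra
open Summit.HubbardSuperconductivity.HubbardSuperconductivity.Theorems.KLProgrammeLegKernels
open Summit.HubbardSuperconductivity.HubbardSuperconductivity.Theorems.KLRegimeSplit
open Summit.HubbardSuperconductivity.HubbardSuperconductivity.Theorems.TwoPointAssembly
open scoped ComplexConjugate

/-! ## §1 Riemann–Lebesgue in the Matsubara label -/

/-- **Riemann–Lebesgue for the cutoff-free six-point coefficient** (fixed volume, every `U`, `μ`, `p`, `β > 0`):
`Six∞_L(n,p) → 0` as the Matsubara integer `n → +∞`.  `Six∞_L(n,p)·D∞` is the Fourier integral `∫ 𝐞(−v w_n)·F(v) dv` of the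
`(0,β]`-supported function `F(v) = Σ_z conj χ_p(z) S∞(z,v)` at `w_n = (2n+1)/(2β) → ∞`. -/
theorem tendsto_klSixInf_natCast_atTop {L : ℕ} [NeZero L] {β : ℝ} (hβ : 0 < β) (U μ : ℝ) (p : TorusSite 2 L) :
    Tendsto (fun n : ℕ => klSixInf L β U μ (n : ℤ) p) atTop (𝓝 0) := by
  set F : ℝ → ℂ := (Set.Ioc 0 β).indicator fun v => ∑ z : TorusSite 2 L, conj (torusChar p z) * klSixWordInf L β U μ z v with hF
  have hw : Tendsto (fun n : ℕ => (2 * (n : ℝ) + 1) / (2 * β)) atTop (cocompact ℝ) := by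
    refine Tendsto.mono_right ?_ atTop_le_cocompact
    refine Tendsto.atTop_div_const (by positivity) ?_
    refine tendsto_atTop_add_const_right _ 1 ?_
    exact tendsto_natCast_atTop_atTop.const_mul_atTop two_pos
  have hRL := (Real.tendsto_integral_exp_smul_cocompact F).comp hw
  have key : ∀ n : ℕ, klSixInf L β U μ (n : ℤ) p =
      (∫ v : ℝ, 𝐞 (-(v * ((2 * (n : ℝ) + 1) / (2 * β)))) • F v) / klDInf L β U μ := by
    intro n
    rw [klSixInf]
    congr 1
    rw [intervalIntegral.integral_of_le hβ.le, ← integral_indicator measurableSet_Ioc]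
    refine integral_congr_ae (Eventually.of_forall fun v => ?_)
    by_cases hv : v ∈ Set.Ioc 0 β
    · simp only [hF, Set.indicator_of_mem hv, Circle.smul_def, Real.fourierChar_apply, smul_eq_mul, Finset.mul_sum]
      refine Finset.sum_congr rfl fun z _ => ?_
      rw [mul_assoc]
      congr 1
      congr 1
      push_cast
      ring
    · simp only [hF, Set.indicator_of_notMem hv, smul_zero]
  have hfun : (fun n : ℕ => klSixInf L β U μ (n : ℤ) p) =
      fun n : ℕ => ((fun w : ℝ => ∫ v : ℝ, 𝐞 (-(v * w)) • F v) ∘ fun n : ℕ => (2 * (n : ℝ) + 1) / (2 * β)) n / klDInf L β U μ := by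
    funext n
    rw [key n]
    rfl
  rw [hfun]
  simpa using hRL.div_const (klDInf L β U μ)

/-! ## §2 The density rate from the bare-carrier rate -/

/-- **(b1) from the bare carrier**: if `‖Σ∞⁰_L(n,0) − Σ∞⁰_{L′}(n,0)‖ ≤ c` for every natural Matsubara label `n`, then
`‖occ∞(L) − occ∞(L′)‖ ≤ c / |U|` (`U ≠ 0`, `β > 0`): `Σ∞⁰ = U·occ∞ + U²·Six∞` and `Six∞_·(n,0) → 0`. -/
theorem kler_occRate_of_carrierRate {β : ℝ} (hβ : 0 < β) {U : ℝ} (hU : U ≠ 0) (μ : ℝ) {L L' : ℕ} [NeZero L] [NeZero L'] {c : ℝ}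
    (h : ∀ n : ℕ, ‖klSelfEnergyInf L β U μ 0 (n : ℤ) 0 - klSelfEnergyInf L' β U μ 0 (n : ℤ) 0‖ ≤ c) :
    ‖klOccInf L β U μ - klOccInf L' β U μ‖ ≤ c / |U| := by
  have hUabs : 0 < |U| := abs_pos.2 hU
  have hlim : Tendsto (fun n : ℕ => klSelfEnergyInf L β U μ 0 (n : ℤ) 0 - klSelfEnergyInf L' β U μ 0 (n : ℤ) 0) atTop
      (𝓝 ((U : ℂ) * (klOccInf L β U μ - klOccInf L' β U μ))) := by
    have h6 := ((tendsto_klSixInf_natCast_atTop hβ U μ (0 : TorusSite 2 L)).sub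
      (tendsto_klSixInf_natCast_atTop hβ U μ (0 : TorusSite 2 L'))).const_mul ((U : ℂ) ^ 2)
    have h7 := h6.const_add ((U : ℂ) * (klOccInf L β U μ - klOccInf L' β U μ))
    rw [sub_zero, mul_zero, add_zero] at h7
    refine h7.congr fun n => ?_
    rw [klSelfEnergyInf_zero_frame hβ.ne', klSelfEnergyInf_zero_frame hβ.ne']
    ring
  have hle : ‖(U : ℂ) * (klOccInf L β U μ - klOccInf L' β U μ)‖ ≤ c :=
    le_of_tendsto hlim.norm (Eventually.of_forall h)
  rw [norm_mul, Complex.norm_real, Real.norm_eq_abs] at hle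
  rw [le_div_iff₀ hUabs, mul_comm]
  exact hle

/-! ## §3 The registered stub `stub_vl_rates` from the bare-carrier rate alone -/

/-- **DOOR: `stub_vl_rates` (skeleton «cauchy» v2 of 19921) VERBATIM from ONE same-cutoff engine statement.**  If, under the stub's own
binder prefix, there are `L₀`, a modulus constant `D` and a rate `ρ → 0` such that for all `L₀ ≤ L ≤ L′` and all cutoffs `M` beyond some
`M₀(L, L′)` the BARE last-scale self-energies at `(L, M)` and `(L′, M)` (frame `0`, spin `0`, the same Matsubara label, any torus momenta)
differ by at most `ρ L + D·Σ_i |p_k i − p′_{k′} i|_𝕋`, then (b1) and (b2) hold as registered (`ρ₁ = ρ/U`, `ρ₂′ = (ρ + |U|·ρ/U)/U²`,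
`D₂ = D/U²`, threshold `max L₀ 3`). -/
theorem stub_vl_rates_of_carrierRate
    (hcar : ∀ (G : GeoConsts) (P : SplitConsts) (Q : EngConsts) (R : RenConsts), G.WF → P.WF → Q.WF → R.WF →
      ∃ c₅ : ℝ, 0 < c₅ ∧ ∀ c : ℝ, 0 < c → c ≤ c₅ → ∃ U₀ : ℝ, 0 < U₀ ∧
        ∀ μ ∈ klWindowC, ∀ U : ℝ, 0 < U → U ≤ U₀ → ∀ β : ℝ, klBetaMin ≤ β → β ≤ Real.exp (c / U ^ 2) →
          ∀ K : TrigPolyC4v, klPredsV14.frameOK R U (nScales β) μ K →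
            ∀ (Lstar : ℕ) (Mstar : ℕ → ℕ), TowerP klPredsV14 G P Q R β U μ K Lstar Mstar →
              ∃ L₀ : ℕ, ∃ D : ℝ, ∃ ρ : ℕ → ℝ, Tendsto ρ atTop (𝓝 0) ∧
                ∀ (L : ℕ) [NeZero L], L₀ ≤ L → ∀ (L' : ℕ) [NeZero L'], L ≤ L' → ∃ M₀ : ℕ, ∀ (M : ℕ) [NeZero M], M₀ ≤ M →
                  ∀ (ω : MatsubaraIdx M) (k : TorusSite 2 L) (k' : TorusSite 2 L'),
                    ‖klSelfEnergy L M β U μ 0 klE0 (nScales β + 1) (ω, k) 0 -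
                        klSelfEnergy L' M β U μ 0 klE0 (nScales β + 1) (ω, k') 0‖ ≤
                      ρ L + D * ∑ i, torusAbs (latticeMomentum L k i - latticeMomentum L' k' i)) :
    ∀ (G : GeoConsts) (P : SplitConsts) (Q : EngConsts) (R : RenConsts), G.WF → P.WF → Q.WF → R.WF →
      ∃ c₅ : ℝ, 0 < c₅ ∧ ∀ c : ℝ, 0 < c → c ≤ c₅ → ∃ U₀ : ℝ, 0 < U₀ ∧
        ∀ μ ∈ klWindowC, ∀ U : ℝ, 0 < U → U ≤ U₀ → ∀ β : ℝ, klBetaMin ≤ β → β ≤ Real.exp (c / U ^ 2) →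
          ∀ K : TrigPolyC4v, klPredsV14.frameOK R U (nScales β) μ K →
            ∀ (Lstar : ℕ) (Mstar : ℕ → ℕ), TowerP klPredsV14 G P Q R β U μ K Lstar Mstar →
              ∃ L₀ : ℕ, ∃ D₂ : ℝ, ∃ ρ₁ : ℕ → ℝ, ∃ ρ₂ : ℕ → ℝ, Tendsto ρ₁ atTop (𝓝 0) ∧ Tendsto ρ₂ atTop (𝓝 0) ∧
                (∀ (L : ℕ) [NeZero L], L₀ ≤ L → ∀ (L' : ℕ) [NeZero L'], L ≤ L' → ‖klOccInf L β U μ - klOccInf L' β U μ‖ ≤ ρ₁ L) ∧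
                (∀ (L : ℕ) [NeZero L], L₀ ≤ L → ∀ (L' : ℕ) [NeZero L'], L ≤ L' →
                  ∀ (n : ℤ) (k : TorusSite 2 L) (k' : TorusSite 2 L'),
                    ‖klSixInf L β U μ n k - klSixInf L' β U μ n k'‖ ≤
                      ρ₂ L + D₂ * ∑ i, torusAbs (latticeMomentum L k i - latticeMomentum L' k' i)) := by
  intro G P Q R hG hP hQ hR
  obtain ⟨c₅, hc₅, hc⟩ := hcar G P Q R hG hP hQ hR
  refine ⟨c₅, hc₅, fun c hc0 hcc => ?_⟩
  obtain ⟨U₀, hU₀, hU⟩ := hc c hc0 hcc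
  refine ⟨U₀, hU₀, fun μ hμ U hU0 hUU β hβmin hβmax K hK Lstar Mstar hT => ?_⟩
  have hβ : 0 < β := KLRegimeSplit.pos_of_klBetaMin_le hβmin
  obtain ⟨L₀, D, ρ, hρ, hS⟩ := hU μ hμ U hU0 hUU β hβmin hβmax K hK Lstar Mstar hT
  -- the modulus term vanishes at the zone centre
  have hzero : ∀ (L₁ L₂ : ℕ), ∑ i, torusAbs (latticeMomentum L₁ (0 : TorusSite 2 L₁) i - latticeMomentum L₂ (0 : TorusSite 2 L₂) i) = 0 := by
    intro L₁ L₂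
    refine Finset.sum_eq_zero fun i _ => ?_
    have h0 : ∀ L₃ : ℕ, latticeMomentum L₃ (0 : TorusSite 2 L₃) i = 0 := fun L₃ => by simp [latticeMomentum]
    rw [h0, h0, sub_zero, torusAbs]
    rw [(toIocMod_eq_self Real.two_pi_pos).2 ⟨by linarith [Real.pi_pos], by linarith [Real.pi_pos]⟩, abs_zero]
  -- (b1) from the carrier rate at the zone centre
  have hocc : ∀ (L : ℕ) [NeZero L], max L₀ 3 ≤ L → ∀ (L' : ℕ) [NeZero L'], L ≤ L' →
      ‖klOccInf L β U μ - klOccInf L' β U μ‖ ≤ ρ L / U := by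
    intro L _ hL L' _ hLL'
    have hL3 : 3 ≤ L := le_of_max_le_right hL
    obtain ⟨M₀, hM₀⟩ := hS L (le_of_max_le_left hL) L' hLL'
    have hcarn : ∀ n : ℕ, ‖klSelfEnergyInf L β U μ 0 (n : ℤ) 0 - klSelfEnergyInf L' β U μ 0 (n : ℤ) 0‖ ≤ ρ L := by
      intro n
      have h1 := kler_carrierRate_of_sameCutoff hβ U μ 0 hL3 (hL3.trans hLL') (n := (n : ℤ)) (k := (0 : TorusSite 2 L))
        (k' := (0 : TorusSite 2 L')) ⟨M₀, fun M _ hM ω _ => hM₀ M hM ω 0 0⟩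
      rwa [hzero, mul_zero, add_zero] at h1
    have h2 := kler_occRate_of_carrierRate hβ hU0.ne' μ hcarn
    rwa [abs_of_pos hU0] at h2
  refine ⟨max L₀ 3, D / U ^ 2, fun L => ρ L / U, fun L => (ρ L + |U| * (ρ L / U)) / U ^ 2, ?_, ?_, hocc, ?_⟩
  · simpa using hρ.div_const U
  · have h := ((hρ.add ((hρ.div_const U).const_mul |U|)).div_const (U ^ 2))
    simpa using h
  · intro L _ hL L' _ hLL' n k k'
    have hL3 : 3 ≤ L := le_of_max_le_right hL
    obtain ⟨M₀, hM₀⟩ := hS L (le_of_max_le_left hL) L' hLL'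
    have hcar' : ‖klSelfEnergyInf L β U μ 0 n k - klSelfEnergyInf L' β U μ 0 n k'‖ ≤
        ρ L + D * ∑ i, torusAbs (latticeMomentum L k i - latticeMomentum L' k' i) :=
      kler_carrierRate_of_sameCutoff hβ U μ 0 hL3 (hL3.trans hLL') ⟨M₀, fun M _ hM ω _ => hM₀ M hM ω k k'⟩
    have h := kler_sixRate_of_carrierRate_occRate hβ.ne' hU0.ne' μ hcar' (hocc L hL L' hLL')
    calc _ ≤ (ρ L + D * ∑ i, torusAbs (latticeMomentum L k i - latticeMomentum L' k' i) + |U| * (ρ L / U)) / U ^ 2 := h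
      _ = (ρ L + |U| * (ρ L / U)) / U ^ 2 + D / U ^ 2 * ∑ i, torusAbs (latticeMomentum L k i - latticeMomentum L' k' i) := by ring

end Summit.HubbardSuperconductivity.HubbardSuperconductivity.Theorems.KLRegimeVolumeLimit

end
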